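import Mathlib
import HarnessLib

/-!
# The classical network-reduced multimachine swing model (model `M_cl`)

Venture GRIDFUSION (LADDER-GRIDFUSION rung G3 → G1), cell `run/shared/lean/pub/gridfusion/`,
`plan/PARTITION.md` §0 row `Models/` (seat gridfusion-model-1). This file TYPES — it does not
validate — the *classical* model of an `n`-machine power system ("constant voltage behind
transient reactance", loads as constant impedances, network reduced to the internal machine
nodes), AS PRINTED in

* P. M. Anderson, A. A. Fouad, *Power System Control and Stability* (Iowa State UP, 1977),
  §2.9, assumptions 1–5 and eqs. (2.53)–(2.57); one machine against an infinite bus §2.7,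
  eqs. (2.40)–(2.42) [galaxy:panama:353492988330019];
* P. W. Sauer, M. A. Pai, *Power System Dynamics and Stability* (Prentice Hall, 1998), §7.9.3,
  eqs. (7.209)–(7.216) (`P_ei = Σ_j E_iE_j(G_ij cos δ_ij + B_ij sin δ_ij)`,
  `dδ_i/dt = ω_i − ω_s`, `(2H_i/ω_s) dω_i/dt = T_Mi − P_ei`), damping torque
  `T_D = D(ω − ω_s)` of §5.7 eq. (5.157) [galaxy:panama:353827995779076].

MODELLED (three-column rule of the cell; README §3 T2/T7): every declaration below is about the
mathematical model `M_cl`. Absent physical effects: excitation / AVR and governor dynamics, flux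
decay and transient saliency, load dynamics (constant impedance only), network and stator
transients, non-synchronous frequency dependence of network parameters; printed appraisal:
Anderson–Fouad §2.11 "Shortcomings of the classical model"; validity row:
`plan/MODEL-VALIDITY.md` (model-2). No declaration here says that any grid is stable.

## Contents

* `ClassicalSwing n` — the parameter record (`M_i = 2H_i/ω_s`, `D_i`, `P_i`, `E_i`, reduced
  admittance `G + jB`);
* `ClassicalSwing.Pe` — electrical power out of internal node `i`, Sauer–Pai (7.212) =
  Anderson–Fouad (2.55); `Pe_eq_polar` — agreement with the polar form `Y_ij cos(θ_ij − δ_i + δ_j)`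
  of (2.54)/(2.56);
* `ClassicalSwing.field` — the vector field in the state `(δ, ω)`, `ω_i` = deviation of the
  electrical speed from synchronous speed `ω_s` (so `dδ_i/dt = ω_i`), (7.215)–(7.216) with the
  damping torque (5.157): `M_i dω_i/dt = P_i − P_ei(δ) − D_i ω_i`;
* `ClassicalSwing.IsEquilibrium` — the pre-transient / equilibrium condition (2.57);
* `ClassicalSwing.IsSolutionOn` — solutions in the tree's `HasDerivWithinAt` convention
  (`Literature/Analysis/ODE/ConfinedAutonomous.lean`);
* `ClassicalSwing.energy` — the classical transient energy function of the LOSSLESS reduced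
  model (transfer conductances dropped), Sauer–Pai §9 (kinetic + position/path-independent
  terms); typed in the ORIGINAL coordinates only: its term `−P_i(δ_i − δ_i^s)` is not a polynomial
  in the recast variables of `Polynomialise.lean`, so it is NOT an SOS warm start there
  (memo §3 item).

## Coordinates and conventions (binding for the cell, PARTITION A1)

Angles in radians, `ω` in rad/s as a DEVIATION from `ω_s`; `M_i = 2H_i/ω_s` (s²/rad in the
per-unit-power convention of both sources); powers per unit. Machine index type `Fin n`.
Relative coordinates with a reference machine and the polynomial recast live in
`Polynomialise.lean`; benchmark instances (`SMIB`, `WSCC9`) in their own files with model-4's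
exact rational data.
-/

noncomputable section

open Real Finset

namespace Summit.Ventures.GridStability.Models

/-- Parameters of the classical network-reduced `n`-machine model `M_cl`
(Anderson–Fouad §2.9 (2.53)–(2.56); Sauer–Pai §7.9.3 (7.209)–(7.216) with (5.157)):
`M i = 2H_i/ω_s` (inertia coefficient), `D i` (damping coefficient multiplying the speed
deviation), `P i` (mechanical power input net of the local constant-impedance load term is NOT
subtracted here — `E_i² G_ii` is part of `Pe`), `E i` (constant internal voltage magnitude),
`G`, `B` (real and imaginary parts of the admittance matrix reduced to the internal nodes,
`Ȳ_ij = G_ij + jB_ij`). MODELLED: absent effects = AVR/governor, flux decay, saliency, load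
dynamics, network transients (A–F §2.11; MODEL-VALIDITY.md row `classical`). -/
structure ClassicalSwing (n : ℕ) where
  /-- inertia coefficients `M_i = 2H_i/ω_s` -/
  M : Fin n → ℝ
  /-- damping coefficients `D_i` (torque `D_i (ω_i − ω_s)`, Sauer–Pai (5.157)) -/
  D : Fin n → ℝ
  /-- mechanical power inputs `P_i` (`T_Mi` of (7.216), `P_mi` of (2.56)) -/
  P : Fin n → ℝ
  /-- internal voltage magnitudes `E_i` behind transient reactance -/
  E : Fin n → ℝ
  /-- reduced conductance matrix `G_ij` -/
  G : Matrix (Fin n) (Fin n) ℝ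
  /-- reduced susceptance matrix `B_ij` -/
  B : Matrix (Fin n) (Fin n) ℝ

namespace ClassicalSwing

variable {n : ℕ} (p : ClassicalSwing n)

/-- The coupling coefficients `C_ij = E_i E_j B_ij` of Sauer–Pai (7.213). -/
def Ccoef (i j : Fin n) : ℝ := p.E i * p.E j * p.B i j

/-- The coupling coefficients `D_ij = E_i E_j G_ij` of Sauer–Pai (7.214) (transfer-conductance
terms; zero in the lossless reduced model). -/
def Dcoef (i j : Fin n) : ℝ := p.E i * p.E j * p.G i j

/-- Electrical power out of internal node `i` at the angle configuration `δ`,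
Sauer–Pai (7.212) = Anderson–Fouad (2.55):
`P_ei = E_i² G_ii + Σ_{j ≠ i} (C_ij sin(δ_i − δ_j) + D_ij cos(δ_i − δ_j))`. -/
def Pe (δ : Fin n → ℝ) (i : Fin n) : ℝ :=
  p.E i ^ 2 * p.G i i +
    ∑ j ∈ univ.erase i, (p.Ccoef i j * sin (δ i - δ j) + p.Dcoef i j * cos (δ i - δ j))

/-- The first line of Sauer–Pai (7.212): `P_ei = Σ_j E_iE_j (G_ij cos δ_ij + B_ij sin δ_ij)`
(full sum including `j = i`, where `sin 0 = 0`, `cos 0 = 1` give the `E_i² G_ii` term). -/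
theorem Pe_eq_sum (δ : Fin n → ℝ) (i : Fin n) :
    p.Pe δ i = ∑ j, p.E i * p.E j * (p.G i j * cos (δ i - δ j) + p.B i j * sin (δ i - δ j)) := by
  classical
  unfold Pe Ccoef Dcoef
  rw [← Finset.add_sum_erase univ _ (mem_univ i)]
  simp only [sub_self, cos_zero, sin_zero, mul_zero, add_zero, mul_one]
  congr 1
  · ring
  · refine Finset.sum_congr rfl fun j _ => ?_
    ring

/-- Agreement with the POLAR form of Anderson–Fouad (2.54)/(2.56): if `G_ij = Y_ij cos θ_ij` and
`B_ij = Y_ij sin θ_ij` then `C_ij sin δ_ij + D_ij cos δ_ij = E_iE_jY_ij cos(θ_ij − δ_i + δ_j)`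
(cosine subtraction formula). -/
theorem coupling_eq_polar (i j : Fin n) (Y θ : ℝ) (hG : p.G i j = Y * cos θ)
    (hB : p.B i j = Y * sin θ) (δ : Fin n → ℝ) :
    p.Ccoef i j * sin (δ i - δ j) + p.Dcoef i j * cos (δ i - δ j) =
      p.E i * p.E j * Y * cos (θ - δ i + δ j) := by
  unfold Ccoef Dcoef
  have h : θ - δ i + δ j = θ - (δ i - δ j) := by ring
  rw [hG, hB, h, cos_sub θ (δ i - δ j)]
  ring

/-- The state space of `M_cl`: angle configuration `δ : Fin n → ℝ` (rad, w.r.t. a synchronously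
rotating frame) and speed deviations `ω : Fin n → ℝ` (rad/s), as a product normed space
(sup norms), the carrier on which solutions are `HasDerivWithinAt`-curves. -/
abbrev State (n : ℕ) : Type := (Fin n → ℝ) × (Fin n → ℝ)

/-- The vector field of `M_cl` in deviation coordinates, Sauer–Pai (7.215)–(7.216) with the
damping torque (5.157) (= Anderson–Fouad (2.56) with `ω` read as the deviation from `ω_R`):
`dδ_i/dt = ω_i`, `dω_i/dt = (P_i − P_ei(δ) − D_i ω_i) / M_i`. -/
def field (x : State n) : State n :=
  (x.2, fun i => (p.P i - p.Pe x.1 i - p.D i * x.2 i) / p.M i)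

/-- `δ^s` is an equilibrium angle configuration of `M_cl` (with all speed deviations zero):
the mechanical input balances the electrical output at every machine — the pre-transient
condition Anderson–Fouad (2.57), `P_mi0 = P_ei0`. -/
def IsEquilibrium (δs : Fin n → ℝ) : Prop := ∀ i, p.Pe δs i = p.P i

/-- At an equilibrium configuration the vector field vanishes on the state `(δ^s, 0)`. -/
theorem field_eq_zero_of_isEquilibrium {δs : Fin n → ℝ} (h : p.IsEquilibrium δs) :
    p.field (δs, 0) = 0 := by
  ext i
  · simp [field]
  · simp [field, h i]

/-- A curve `γ : ℝ → State n` solves `M_cl` on the time set `s` (tree convention of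
`Literature/Analysis/ODE`: derivative within `s` at every `t ∈ s`). -/
def IsSolutionOn (γ : ℝ → State n) (s : Set ℝ) : Prop :=
  ∀ t ∈ s, HasDerivWithinAt γ (p.field (γ t)) s t

/-- `M_cl` is LOSSLESS (as a reduced network): all transfer conductances vanish, `G_ij = 0` for
`i ≠ j` (self-conductances `G_ii`, which carry the constant-impedance loads, may be nonzero).
The classical energy function is an exact first integral up to damping only in this case
(Sauer–Pai §9, transfer-conductance terms are path dependent). -/
def IsLossless : Prop := ∀ i j, i ≠ j → p.G i j = 0

/-- The classical transient energy function of the lossless reduced model relative to the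
equilibrium configuration `δ^s` (Sauer–Pai §9, kinetic energy + rotor position energy + magnetic
stored energy; the conductance / `E_i²G_ii` parts are absorbed in `P_i' = P_i − E_i² G_ii`):
`V(δ, ω) = ½ Σ_i M_i ω_i² − Σ_i (P_i − E_i²G_ii)(δ_i − δ_i^s)
  − Σ_{i<j} C_ij (cos(δ_i − δ_j) − cos(δ_i^s − δ_j^s))`.
NOT polynomial in the recast variables `(sin, 1 − cos)` because of the linear angle term. -/
def energy (δs : Fin n → ℝ) (x : State n) : ℝ :=
  (∑ i, p.M i * x.2 i ^ 2) / 2 - ∑ i, (p.P i - p.E i ^ 2 * p.G i i) * (x.1 i - δs i) -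
    ∑ i, ∑ j ∈ univ.filter (fun j => i < j),
      p.Ccoef i j * (cos (x.1 i - x.1 j) - cos (δs i - δs j))

end ClassicalSwing

end Summit.Ventures.GridStability.Models
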